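import Summits.KontsevichZagierPeriods.KontsevichZagierPeriods.Theorems.MzvKernelInKZ.Negative.WeightsTwoThree

/-!
# `MzvKernelInKZ` (stmt-KontsevichZagierPeriods-3914): negative side — the weight-4 rung as typed memberships

Companion of `Negative/WeightsTwoThree.lean`.  **The weight-4 rung is equivalent to typed
memberships**: `WeightKernelAdm 4 ⟺ cFds4 ∧ cEuler4 ∧ cDual4 ∈ relations`
(`weightKernelAdm_four_iff`; finite double shuffle `ζ(4) = 4ζ(3,1)`, Euler `3ζ(4) = 4ζ(2,2)`,
duality `ζ(4) = ζ(2,1,1)`), equivalently with Hoffman's relation `ζ(4) = ζ(3,1) + ζ(2,2)` in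
place of Euler's (`weightKernelAdm_four_iff'`); and since duality is one move
(`cDual4_mem_relations`), `WeightKernelAdm 4 ⟺ cFds4 ∧ cEuler4` (`…_iff_two_targets`).  The
converse direction is the rank-one engine with base word `0001` (`ζ(4) = π⁴/90 ≠ 0`).

Sources: M. Kontsevich, D. Zagier, *Periods* (2001), §1.2; M. E. Hoffman, *Multiple harmonic
series*, Pacific J. Math. 152 (1992) (the relation `ζ(4) = ζ(3,1) + ζ(2,2)`); D. Zagier (1994), §9. -/

noncomputable section

namespace Summit.KontsevichZagierPeriods.MzvKernelInKZ.Negative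

open Set MeasureTheory MvPolynomial
open Literature.NumberTheory.Transcendental
open Summit.KontsevichZagierPeriods.KontsevichZagierPeriods.Theses.LinRedNormalForm (MzvKernelInKZ)

/-- TYPED TARGET (finite double shuffle at weight 4, route Grothendieck item 0275):
`[Δ₄, ω₀₀₀₁] − [Δ₄, 4·ω₀₀₁₁]`, value `ζ(4) − 4ζ(3,1) = 0`. [folklore] -/
def cFds4 : KZ.FormalRep := KZ.of (wordRep ω4 1 adm_ω4) - KZ.of (wordRep ω31 4 adm_ω31)

/-- TYPED TARGET (Euler's evaluation `ζ(2,2) = ¾ζ(4)`, = 4·Hoffman − FDS):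
`[Δ₄, 3·ω₀₀₀₁] − [Δ₄, 4·ω₀₁₀₁]`, value `3ζ(4) − 4ζ(2,2) = 0`. [folklore] -/
def cEuler4 : KZ.FormalRep := KZ.of (wordRep ω4 3 adm_ω4) - KZ.of (wordRep ω22 4 adm_ω22)

/-- TYPED TARGET (duality at weight 4): `[Δ₄, ω₀₀₀₁] − [Δ₄, ω₀₁₁₁]`, value `ζ(4) − ζ(2,1,1) = 0`;
one change-of-variables move (`cDual4_mem_relations` below). [folklore] -/
def cDual4 : KZ.FormalRep := KZ.of (wordRep ω4 1 adm_ω4) - KZ.of (wordRep ω211 1 adm_ω211)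

/-- TYPED TARGET (Hoffman's relation at weight 4, the live instance of cruxes
HoffmanRelationInKZ 3930 / CoactionDevissage 3167 / Deregularisation 3906):
`[Δ₄, ω₀₀₀₁] − [Δ₄, ω₀₀₁₁] − [Δ₄, ω₀₁₀₁]`, value `ζ(4) − ζ(3,1) − ζ(2,2) = 0`. [folklore] -/
def cHoffman4 : KZ.FormalRep :=
  KZ.of (wordRep ω4 1 adm_ω4) - KZ.of (wordRep ω31 1 adm_ω31) - KZ.of (wordRep ω22 1 adm_ω22)

/-- `cFds4` lies in the admissible weight-4 closure. [folklore] -/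
theorem cFds4_mem_closure : cFds4 ∈ AddSubgroup.closure (genSetAdm 4) :=
  sub_mem (AddSubgroup.subset_closure (of_wordRep_mem_genSetAdm _ _ _))
    (AddSubgroup.subset_closure (of_wordRep_mem_genSetAdm _ _ _))

/-- `cEuler4` lies in the admissible weight-4 closure. [folklore] -/
theorem cEuler4_mem_closure : cEuler4 ∈ AddSubgroup.closure (genSetAdm 4) :=
  sub_mem (AddSubgroup.subset_closure (of_wordRep_mem_genSetAdm _ _ _))
    (AddSubgroup.subset_closure (of_wordRep_mem_genSetAdm _ _ _))

/-- `cDual4` lies in the admissible weight-4 closure. [folklore] -/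
theorem cDual4_mem_closure : cDual4 ∈ AddSubgroup.closure (genSetAdm 4) :=
  sub_mem (AddSubgroup.subset_closure (of_wordRep_mem_genSetAdm _ _ _))
    (AddSubgroup.subset_closure (of_wordRep_mem_genSetAdm _ _ _))

/-- `cHoffman4` lies in the admissible weight-4 closure. [folklore] -/
theorem cHoffman4_mem_closure : cHoffman4 ∈ AddSubgroup.closure (genSetAdm 4) :=
  sub_mem (sub_mem (AddSubgroup.subset_closure (of_wordRep_mem_genSetAdm _ _ _))
    (AddSubgroup.subset_closure (of_wordRep_mem_genSetAdm _ _ _)))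
    (AddSubgroup.subset_closure (of_wordRep_mem_genSetAdm _ _ _))

/-- `cFds4` evaluates to `ζ(4) − 4ζ(3,1) = 0`. [folklore] -/
theorem eval_cFds4 : KZ.eval cFds4 = 0 := by
  rw [cFds4, map_sub, KZ.eval_of, KZ.eval_of, value_wordRep ω31 4, value_ω4, value_ω31]
  ring

/-- `cEuler4` evaluates to `3ζ(4) − 4ζ(2,2) = 0`. [folklore] -/
theorem eval_cEuler4 : KZ.eval cEuler4 = 0 := by
  rw [cEuler4, map_sub, KZ.eval_of, KZ.eval_of, value_wordRep ω4 3, value_wordRep ω22 4, value_ω4,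
    value_ω22]
  ring

/-- `cDual4` evaluates to `ζ(4) − ζ(2,1,1) = 0`. [folklore] -/
theorem eval_cDual4 : KZ.eval cDual4 = 0 := by
  rw [cDual4, map_sub, KZ.eval_of, KZ.eval_of, value_ω4, value_ω211, sub_self]

/-- `cHoffman4` evaluates to `ζ(4) − ζ(3,1) − ζ(2,2) = 0` (Hoffman's relation at weight 4). [folklore] -/
theorem eval_cHoffman4 : KZ.eval cHoffman4 = 0 := by
  rw [cHoffman4, map_sub, map_sub, KZ.eval_of, KZ.eval_of, KZ.eval_of, value_ω4, value_ω31,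
    value_ω22]
  ring

/-- The admissible words of weight `4` are `0001`, `0011`, `0101`, `0111`. [folklore] -/
theorem adm_four_cases {ε : Fin 4 → Bool} (hε : Adm ε) :
    ε = ω4 ∨ ε = ω31 ∨ ε = ω22 ∨ ε = ω211 := by
  obtain ⟨h0, h3⟩ := hε (by decide)
  cases h1 : ε 1 <;> cases h2 : ε 2
  · left
    funext i; fin_cases i
    · simpa [ω4] using h0
    · simpa [ω4] using h1
    · simpa [ω4] using h2
    · simpa [ω4] using h3
  · right; left
    funext i; fin_cases i
    · simpa [ω31] using h0
    · simpa [ω31] using h1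
    · simpa [ω31] using h2
    · simpa [ω31] using h3
  · right; right; left
    funext i; fin_cases i
    · simpa [ω22] using h0
    · simpa [ω22] using h1
    · simpa [ω22] using h2
    · simpa [ω22] using h3
  · right; right; right
    funext i; fin_cases i
    · simpa [ω211] using h0
    · simpa [ω211] using h1
    · simpa [ω211] using h2
    · simpa [ω211] using h3

/-- **Weight 4 ⟺ three typed memberships** (finite double shuffle, Euler, duality).  The converse
direction is the rank-one engine with base word `ω₀₀₀₁` (`ζ(4) = π⁴/90 ≠ 0`) and ratios
`¼, ¾, 1` obtained from the three targets by rational rescaling (`KZ.scale`). [folklore] -/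
theorem weightKernelAdm_four_iff :
    WeightKernelAdm 4 ↔
      cFds4 ∈ KZ.relations ∧ cEuler4 ∈ KZ.relations ∧ cDual4 ∈ KZ.relations := by
  constructor
  · intro h
    exact ⟨h _ cFds4_mem_closure eval_cFds4, h _ cEuler4_mem_closure eval_cEuler4,
      h _ cDual4_mem_closure eval_cDual4⟩
  · rintro ⟨hF, hE, hD⟩
    refine weightKernelAdm_of_rankOne ω4 adm_ω4 value_ω4_ne_zero
      (fun ε => if ε = ω31 then 1 / 4 else if ε = ω22 then 3 / 4 else 1) fun ε hε => ?_
    rcases adm_four_cases hε with rfl | rfl | rfl | rfl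
    · simp [ω4, ω31, ω22]
    · have h := of_wordRep_smul_of adm_ω4 adm_ω31 hF (1 / 4)
      norm_num at h
      simpa [ω31, ω22] using KZ.relations.neg_mem h
    · have h := of_wordRep_smul_of adm_ω4 adm_ω22 hE (1 / 4)
      norm_num at h
      have h22 : ¬ (ω22 = ω31) := by decide
      simpa [h22] using KZ.relations.neg_mem h
    · have h1 : ¬ (ω211 = ω31) := by decide
      have h2 : ¬ (ω211 = ω22) := by decide
      simpa [h1, h2, cDual4] using KZ.relations.neg_mem hD

/-- Hoffman ↔ Euler given finite double shuffle: pure bookkeeping inside the calculus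
(`[ω₃₁] ≡ [¼ω₄]`, integrand additivity `[¼ω₄] + [¾ω₄] ≡ [ω₄]`, rescaling by `4` and `¼`). [folklore] -/
theorem cHoffman4_mem_iff_cEuler4_mem (hF : cFds4 ∈ KZ.relations) :
    cHoffman4 ∈ KZ.relations ↔ cEuler4 ∈ KZ.relations := by
  -- `[ω₃₁] − [¼ ω₄]`
  have h31 : KZ.of (wordRep ω31 1 adm_ω31) - KZ.of (wordRep ω4 (1 / 4) adm_ω4) ∈ KZ.relations := by
    have h := of_wordRep_smul_of adm_ω4 adm_ω31 hF (1 / 4)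
    norm_num at h
    simpa using KZ.relations.neg_mem h
  -- `[ω₄] − [¼ω₄] − [¾ω₄]`
  have hadd : KZ.of (wordRep ω4 1 adm_ω4) - KZ.of (wordRep ω4 (1 / 4) adm_ω4) -
      KZ.of (wordRep ω4 (3 / 4) adm_ω4) ∈ KZ.relations := by
    have h := of_wordRep_add ω4 (1 / 4) (3 / 4) adm_ω4
    norm_num at h
    exact h
  constructor
  · intro hH
    -- `[ω₂₂] ≡ [ω₄] − [ω₃₁] ≡ [¾ω₄]`, then rescale by 4
    have h22 : KZ.of (wordRep ω22 1 adm_ω22) - KZ.of (wordRep ω4 (3 / 4) adm_ω4) ∈ KZ.relations := by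
      have : KZ.of (wordRep ω22 1 adm_ω22) - KZ.of (wordRep ω4 (3 / 4) adm_ω4) =
          (KZ.of (wordRep ω4 1 adm_ω4) - KZ.of (wordRep ω4 (1 / 4) adm_ω4) -
            KZ.of (wordRep ω4 (3 / 4) adm_ω4)) - cHoffman4 -
          (KZ.of (wordRep ω31 1 adm_ω31) - KZ.of (wordRep ω4 (1 / 4) adm_ω4)) := by
        simp only [cHoffman4]; abel
      rw [this]
      exact KZ.relations.sub_mem (KZ.relations.sub_mem hadd hH) h31
    have h := of_wordRep_smul_of adm_ω22 adm_ω4 h22 4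
    norm_num at h
    simpa [cEuler4] using KZ.relations.neg_mem h
  · intro hE
    have h22 : KZ.of (wordRep ω22 1 adm_ω22) - KZ.of (wordRep ω4 (3 / 4) adm_ω4) ∈ KZ.relations := by
      have h := of_wordRep_smul_of adm_ω4 adm_ω22 hE (1 / 4)
      norm_num at h
      simpa using KZ.relations.neg_mem h
    have : cHoffman4 = (KZ.of (wordRep ω4 1 adm_ω4) - KZ.of (wordRep ω4 (1 / 4) adm_ω4) -
        KZ.of (wordRep ω4 (3 / 4) adm_ω4)) -
        (KZ.of (wordRep ω31 1 adm_ω31) - KZ.of (wordRep ω4 (1 / 4) adm_ω4)) -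
        (KZ.of (wordRep ω22 1 adm_ω22) - KZ.of (wordRep ω4 (3 / 4) adm_ω4)) := by
      simp only [cHoffman4]; abel
    rw [this]
    exact KZ.relations.sub_mem (KZ.relations.sub_mem hadd h31) h22

/-- The weight-4 rung in the form the idea cards use (FDS 0275, Hoffman 3930, duality 3933). [folklore] -/
theorem weightKernelAdm_four_iff' :
    WeightKernelAdm 4 ↔
      cFds4 ∈ KZ.relations ∧ cHoffman4 ∈ KZ.relations ∧ cDual4 ∈ KZ.relations := by
  rw [weightKernelAdm_four_iff]
  constructor
  · rintro ⟨hF, hE, hD⟩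
    exact ⟨hF, (cHoffman4_mem_iff_cEuler4_mem hF).mpr hE, hD⟩
  · rintro ⟨hF, hH, hD⟩
    exact ⟨hF, (cHoffman4_mem_iff_cEuler4_mem hF).mp hH, hD⟩

/-- What the crux itself says at weight 4: the four typed elements ARE relations (if it holds). [folklore] -/
theorem targets_of_crux (h : MzvKernelInKZ) :
    cDual3 ∈ KZ.relations ∧ cFds4 ∈ KZ.relations ∧ cEuler4 ∈ KZ.relations ∧
      cHoffman4 ∈ KZ.relations ∧ cDual4 ∈ KZ.relations := by
  have h3 := weightKernelAdm_of_crux (w := 3) h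
  have h4 := weightKernelAdm_of_crux (w := 4) h
  exact ⟨h3 _ cDual3_mem_closure eval_cDual3, h4 _ cFds4_mem_closure eval_cFds4,
    h4 _ cEuler4_mem_closure eval_cEuler4, h4 _ cHoffman4_mem_closure eval_cHoffman4,
    h4 _ cDual4_mem_closure eval_cDual4⟩

/-- `(0001)† = 0111`. [folklore] -/
theorem dualWord_ω4 : dualWord ω4 = ω211 := by decide

/-- `ζ(2,1,1) = ζ(4)` inside the calculus: `cDual4` is one move. [folklore] -/
theorem cDual4_mem_relations : cDual4 ∈ KZ.relations := by
  have h := duality_mem_relations ω4 1 adm_ω4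
  rw [wordRep_congr dualWord_ω4 1 (adm_dualWord adm_ω4) adm_ω211] at h
  exact h

/-- **THE WEIGHT-4 RUNG ⟺ TWO TYPED MEMBERSHIPS**: the finite double shuffle element `cFds4`
(`ζ(4) = 4ζ(3,1)`, item 0275) and the Euler element `cEuler4` (`3ζ(4) = 4ζ(2,2)`). [folklore] -/
theorem weightKernelAdm_four_iff_two_targets :
    WeightKernelAdm 4 ↔ cFds4 ∈ KZ.relations ∧ cEuler4 ∈ KZ.relations := by
  rw [weightKernelAdm_four_iff]
  exact ⟨fun h => ⟨h.1, h.2.1⟩, fun h => ⟨h.1, h.2, cDual4_mem_relations⟩⟩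

/-- Same with Hoffman's relation in place of Euler's evaluation. [folklore] -/
theorem weightKernelAdm_four_iff_fds_hoffman :
    WeightKernelAdm 4 ↔ cFds4 ∈ KZ.relations ∧ cHoffman4 ∈ KZ.relations := by
  rw [weightKernelAdm_four_iff']
  exact ⟨fun h => ⟨h.1, h.2.1⟩, fun h => ⟨h.1, h.2, cDual4_mem_relations⟩⟩

end Summit.KontsevichZagierPeriods.MzvKernelInKZ.Negative
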